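import Literature.Probability.Percolation.QuadCrossingContinuityOfBound
import Literature.Probability.Percolation.QuadCrossingContinuityTame
import Literature.Probability.Percolation.QuadCrossingContinuityCaseThreeTameAll
import Summits.CriticalPhenomena.CardyFormulaZ2.Theorems.CardySelfRefinementLagHandOffQuadContinuityPar1
import HarnessLib

/-!
# Quad continuity for parallelograms, part 2: the tame Lemma 6.1 step for parallelogram pairs

Stub `stub_quadContinuity_parallelogram` (sub-goal of `stub_quadContinuity`) of line
`hitting-tournament` for crux `CardySelfRefinement.LagHandOff` (stmt-CriticalPhenomena-10268),
parallelogram case of [SchrammSmirnov2011, Lemma 5.1] through the tame cases of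
[SchrammSmirnov2011, Lemma 6.1].

A quad `P = H ∘ rectChart u₀ u₁ v₀ v₁` read through an AFFINE homeomorphism `H z = a + L z`
(`L : ℂ ≃L[ℝ] ℂ`) is a parallelogram: its carrier and sides are convex
(`convex_carrier_of_affine_chart`, …), hence lattice-tame at every mesh (a lattice edge segment
meets `[P]` in a convex, so preconnected, set), its free sides are straight (`1`-chord–arc) and
`[P]` is star-shaped at every point; for a pair `(P, P')` under condition (3) the cut point of
part 1 applies (`exists_cut_of_affine_chart`).  Feeding these provisos into the tree's proved
tame forms of Lemma 6.1,
`real_symmDiff_crossedEvent_le_of_isPerturbationTwo_of_tame₃_all` (condition (2)) and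
`real_symmDiff_crossedEvent_le_of_isPerturbationThree_of_tame_all` (condition (3)), gives the
ONE-STEP ESTIMATE of the proof of Lemma 5.1 for parallelogram pairs
(`exists_rho_affine_step`): for every `m, ε' > 0` there is `ρ > 0` such that
`μ_η(⊞_P Δ ⊞_{P'}) ≤ ε'` for all `0 < η < ρ` whenever `P, P'` are chart quads of the same affine
`H`, `d₀(P) ≥ m`, and `P'` is a `ρ`-perturbation of `P` of type (2) or (3).
-/

noncomputable section

open Set Metric Filter MeasureTheory
open scoped unitInterval Topology ENNReal
open Literature.Probability.Percolation Literature.Probability.LatticeModels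
open Literature.Probability.Percolation.QuadCrossing Literature.Topology.PlaneTopology

namespace Summit.CriticalPhenomena.CardyFormulaZ2.Cruxes.LagHandOff.HittingTournament

/-! ### Parallelogram chart quads are convex -/

variable {D : Set ℂ}

/-- The carrier of a chart quad of an affine homeomorphism is convex (a parallelogram). -/
theorem convex_carrier_of_affine_chart {a : ℂ} {L : ℂ ≃L[ℝ] ℂ} {H : ℂ ≃ₜ ℂ}
    (hH : ∀ z, H z = a + L z) {P : Quad D} {u₀ u₁ v₀ v₁ : ℝ}
    (hP : ∀ p, P p = H (Quad.rectChart u₀ u₁ v₀ v₁ p)) (hu : u₀ ≠ u₁) (hv : v₀ ≠ v₁) :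
    Convex ℝ P.carrier := by
  rw [Quad.carrier_eq_of_chart hP hu hv]
  exact convex_image_of_affine hH (convex_Icc_reProdIm_Icc _ _ _ _)

/-- Side `0` of a chart quad of an affine homeomorphism is convex (a straight segment). -/
theorem convex_side_zero_of_affine_chart {a : ℂ} {L : ℂ ≃L[ℝ] ℂ} {H : ℂ ≃ₜ ℂ}
    (hH : ∀ z, H z = a + L z) {P : Quad D} {u₀ u₁ v₀ v₁ : ℝ}
    (hP : ∀ p, P p = H (Quad.rectChart u₀ u₁ v₀ v₁ p)) (hv : v₀ ≠ v₁) :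
    Convex ℝ (P.side 0) := by
  rw [Quad.side_zero_eq_of_chart hP hv, ← Icc_self]
  exact convex_image_of_affine hH (convex_Icc_reProdIm_Icc _ _ _ _)

/-- Side `2` of a chart quad of an affine homeomorphism is convex (a straight segment). -/
theorem convex_side_two_of_affine_chart {a : ℂ} {L : ℂ ≃L[ℝ] ℂ} {H : ℂ ≃ₜ ℂ}
    (hH : ∀ z, H z = a + L z) {P : Quad D} {u₀ u₁ v₀ v₁ : ℝ}
    (hP : ∀ p, P p = H (Quad.rectChart u₀ u₁ v₀ v₁ p)) (hv : v₀ ≠ v₁) :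
    Convex ℝ (P.side 2) := by
  rw [Quad.side_two_eq_of_chart hP hv, ← Icc_self]
  exact convex_image_of_affine hH (convex_Icc_reProdIm_Icc _ _ _ _)

/-- **Lattice tameness from convexity**: a segment meets a convex carrier in a preconnected
set. -/
theorem isPreconnected_segment_inter_of_convex {C : Set ℂ} (hC : Convex ℝ C) (p q : ℂ) :
    IsPreconnected (segment ℝ p q ∩ C) :=
  ((convex_segment p q).inter hC).isPreconnected

/-- The free side `u ↦ P'(1, u)` of an affine chart quad is affinely parametrised. -/
theorem apply_one_eq_of_affine_chart {a : ℂ} {L : ℂ ≃L[ℝ] ℂ} {H : ℂ ≃ₜ ℂ}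
    (hH : ∀ z, H z = a + L z) {P : Quad D} {u₀ u₁ v₀ v₁ : ℝ}
    (hP : ∀ p, P p = H (Quad.rectChart u₀ u₁ v₀ v₁ p)) (u : I) :
    P (1, u) = (a + (u₁ : ℂ) * L 1 + (v₀ : ℂ) * L Complex.I) +
      ((u : ℝ) : ℂ) * (((v₁ - v₀ : ℝ) : ℂ) * L Complex.I) := by
  rw [hP, Quad.rectChart, affine_apply_ofReal_add_ofReal_mul_I hH]
  push_cast
  ring

/-- The top side `t ↦ P'.rot (1, t) = P'(1 - t, 1)` of an affine chart quad is affinely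
parametrised. -/
theorem rot_apply_one_eq_of_affine_chart {a : ℂ} {L : ℂ ≃L[ℝ] ℂ} {H : ℂ ≃ₜ ℂ}
    (hH : ∀ z, H z = a + L z) {P : Quad D} {u₀ u₁ v₀ v₁ : ℝ}
    (hP : ∀ p, P p = H (Quad.rectChart u₀ u₁ v₀ v₁ p)) (t : I) :
    P.rot (1, t) = (a + (u₁ : ℂ) * L 1 + (v₁ : ℂ) * L Complex.I) +
      ((t : ℝ) : ℂ) * (-(((u₁ - u₀ : ℝ) : ℂ) * L 1)) := by
  rw [Quad.rot_apply, hP, Quad.rectChart, affine_apply_ofReal_add_ofReal_mul_I hH]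
  simp only [unitInterval.coe_symm_eq]
  push_cast
  ring

/-- **The cut point for a parallelogram pair under condition (3)** (the `∃ ζ` hypothesis of
`real_symmDiff_crossedEvent_le_of_isPerturbationThree_of_tame_all`): along the straight top side
`t ↦ P'.rot (1, t)` of `P'`, running from `∂₂P` to `∂₀P` inside the parallelogram `[P]`, points
of parameter `≤ ζ` are `d₀(P)/4`-far (along paths in `[P]`) from `∂₀P` and points of parameter
`≥ ζ` are `d₀(P)/4`-far from `∂₂P` (`exists_cut_of_convex` with `d = d₀(P)`; a path has diameter
at least the distance of its endpoints). -/
theorem exists_cut_of_affine_chart {a : ℂ} {L : ℂ ≃L[ℝ] ℂ} {H : ℂ ≃ₜ ℂ}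
    (hH : ∀ z, H z = a + L z) {P P' : Quad D} {u₀ u₁ v₀ v₁ u₀' u₁' v₀' v₁' : ℝ}
    (hP : ∀ p, P p = H (Quad.rectChart u₀ u₁ v₀ v₁ p))
    (hP' : ∀ p, P' p = H (Quad.rectChart u₀' u₁' v₀' v₁' p)) (hu : u₀ ≠ u₁) (hv : v₀ ≠ v₁)
    (hcar : P'.carrier ⊆ P.carrier) (h0 : P'.side 0 ⊆ P.side 0) (h2 : P'.side 2 ⊆ P.side 2) :
    ∃ ζ : ℝ,
      (∀ t : I, (t : ℝ) ≤ ζ → ∀ y ∈ P.side 0, ∀ p : Path (P'.rot (1, t)) y,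
        range p ⊆ P.carrier → P.sideDist 0 / 4 ≤ diam (range p)) ∧
      (∀ t : I, ζ ≤ (t : ℝ) → ∀ y ∈ P.side 2, ∀ p : Path (P'.rot (1, t)) y,
        range p ⊆ P.carrier → P.sideDist 0 / 4 ≤ diam (range p)) := by
  have hx := rot_apply_one_eq_of_affine_chart hH hP'
  have hx0 : P'.rot (1, 0) ∈ P.side 2 := by
    rw [Quad.rot_apply, unitInterval.symm_zero]
    exact h2 ⟨(1, 1), rfl, rfl⟩
  have hx1 : P'.rot (1, 1) ∈ P.side 0 := by
    rw [Quad.rot_apply, unitInterval.symm_one]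
    exact h0 ⟨(0, 1), rfl, rfl⟩
  have hxC : ∀ t, P'.rot (1, t) ∈ P.carrier := fun t => hcar ⟨(σ t, 1), rfl⟩
  have hdle : ∀ y₀ ∈ P.side 0, ∀ y₂ ∈ P.side 2, ∀ γ : Path y₀ y₂, range γ ⊆ P.carrier →
      P.sideDist 0 ≤ diam (range γ) := fun y₀ hy₀ y₂ hy₂ γ hγ =>
    Quad.sideDist_le hy₀ (by rw [show (0 : Fin 4) + 2 = 2 from rfl]; exact hy₂) γ hγ
  obtain ⟨ζ, hA, hB⟩ := exists_cut_of_convex (x := fun t => P'.rot (1, t))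
    (P.isCompact_side 0) (P.isCompact_side 2)
    (P.side_subset_carrier 0) (P.side_subset_carrier 2) (convex_carrier_of_affine_chart hH hP hu hv)
    (convex_side_zero_of_affine_chart hH hP hv) (convex_side_two_of_affine_chart hH hP hv)
    (P.sideDist_nonneg 0) hdle hx hx0 hx1 hxC
  have hd4 : P.sideDist 0 / 4 ≤ P.sideDist 0 / 2 := by linarith [P.sideDist_nonneg 0]
  refine ⟨ζ, fun t ht y hy p _ => ?_, fun t ht y hy p _ => ?_⟩
  · calc P.sideDist 0 / 4 ≤ P.sideDist 0 / 2 := hd4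
      _ ≤ infDist (P'.rot (1, t)) (P.side 0) := hA t ht
      _ ≤ dist (P'.rot (1, t)) y := infDist_le_dist_of_mem hy
      _ ≤ diam (range p) := Quad.dist_le_diam_range_path p
  · calc P.sideDist 0 / 4 ≤ P.sideDist 0 / 2 := hd4
      _ ≤ infDist (P'.rot (1, t)) (P.side 2) := hB t ht
      _ ≤ dist (P'.rot (1, t)) y := infDist_le_dist_of_mem hy
      _ ≤ diam (range p) := Quad.dist_le_diam_range_path p

/-! ### The one-step estimate for parallelogram pairs -/

/-- A positive perturbation size `ρ` making two power-law bounds small and lying in two linear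
regimes exists (the bounds tend to `0` as `ρ → 0⁺`). -/
theorem exists_rho_small {m ε' α₂ C₂ c₂ α₃ C₃ c₃ : ℝ} (hm : 0 < m) (hε' : 0 < ε')
    (hα₂ : 0 < α₂) (hc₂ : 0 < c₂) (hα₃ : 0 < α₃) (hc₃ : 0 < c₃) :
    ∃ ρ : ℝ, 0 < ρ ∧ ρ ≤ c₂ * m ∧ ρ ≤ c₃ * m ∧ 3 * (C₂ / m * ρ) ^ α₂ ≤ ε' ∧
      2 * (C₃ / m * ρ) ^ α₃ ≤ ε' := by
  have t2 : Tendsto (fun ρ : ℝ => 3 * (C₂ / m * ρ) ^ α₂) (𝓝[>] 0) (𝓝 0) := by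
    have := (tendsto_const_mul_rpow_nhdsWithin_zero (C₂ / m) hα₂).const_mul 3
    rwa [mul_zero] at this
  have t3 : Tendsto (fun ρ : ℝ => 2 * (C₃ / m * ρ) ^ α₃) (𝓝[>] 0) (𝓝 0) := by
    have := (tendsto_const_mul_rpow_nhdsWithin_zero (C₃ / m) hα₃).const_mul 2
    rwa [mul_zero] at this
  have e2 : ∀ᶠ ρ in 𝓝[>] (0 : ℝ), 3 * (C₂ / m * ρ) ^ α₂ < ε' := t2 (Iio_mem_nhds hε')
  have e3 : ∀ᶠ ρ in 𝓝[>] (0 : ℝ), 2 * (C₃ / m * ρ) ^ α₃ < ε' := t3 (Iio_mem_nhds hε')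
  have epos : ∀ᶠ ρ in 𝓝[>] (0 : ℝ), 0 < ρ := self_mem_nhdsWithin
  have esmall : ∀ᶠ ρ in 𝓝[>] (0 : ℝ), ρ < min (c₂ * m) (c₃ * m) :=
    nhdsWithin_le_nhds (Iio_mem_nhds (lt_min (mul_pos hc₂ hm) (mul_pos hc₃ hm)))
  obtain ⟨ρ, ⟨h2, h3⟩, hpos, hsmall⟩ := ((e2.and e3).and (epos.and esmall)).exists
  exact ⟨ρ, hpos, (hsmall.le.trans (min_le_left _ _)), (hsmall.le.trans (min_le_right _ _)),
    h2.le, h3.le⟩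

/-- `(C · 1 · ρ / d)^α ≤ (C/m · ρ)^α` for `d ≥ m > 0`. -/
theorem rpow_div_le_rpow_div {C ρ d m α : ℝ} (hC : 0 < C) (hρ : 0 < ρ) (hm : 0 < m)
    (hmd : m ≤ d) (hα : 0 < α) : (C * 1 * ρ / d) ^ α ≤ (C / m * ρ) ^ α := by
  have hd : 0 < d := hm.trans_le hmd
  have h0 : 0 ≤ C * 1 * ρ / d := by positivity
  refine Real.rpow_le_rpow h0 ?_ hα.le
  calc C * 1 * ρ / d ≤ C * 1 * ρ / m := div_le_div_of_nonneg_left (by positivity) hm hmd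
    _ = C / m * ρ := by ring

/-- **The one-step estimate of the proof of Lemma 5.1 for parallelogram pairs** (parallelogram
case of [SchrammSmirnov2011, Lemma 6.1 (2), (3)], from the tree's tame theorems).  Let `H` be an
affine homeomorphism `z ↦ a + L z` of the plane and `m, ε' > 0`.  There is `ρ > 0` such that
for all chart quads `P = H ∘ rectChart u₀ u₁ v₀ v₁`, `P' = H ∘ rectChart u₀' u₁' v₀' v₁'` of any
`D` with `d₀(P) ≥ m`, if `P'` is a `ρ`-perturbation of `P` of type (2) or (3) then
`μ_η(⊞_P Δ ⊞_{P'}) ≤ ε'` for every `0 < η < ρ`.  The tameness provisos of the two tree theorems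
hold for parallelograms: `[P]`, `[P']` are convex (lattice-tame at all meshes, star-shaped), the
free side of `P'` is straight (`K = 1`), and the cut point exists by `exists_cut_of_affine_chart`;
`ρ` is then fixed by `d(P) ≥ d₀(P) ≥ m` and the power laws of the two theorems. -/
theorem exists_rho_affine_step {a : ℂ} {L : ℂ ≃L[ℝ] ℂ} {H : ℂ ≃ₜ ℂ} (hH : ∀ z, H z = a + L z)
    {m : ℝ} (hm : 0 < m) {ε' : ℝ} (hε' : 0 < ε') :
    ∃ ρ : ℝ, 0 < ρ ∧ ∀ (D : Set ℂ) (P P' : Quad D) (u₀ u₁ v₀ v₁ u₀' u₁' v₀' v₁' : ℝ),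
      (∀ p, P p = H (Quad.rectChart u₀ u₁ v₀ v₁ p)) →
      (∀ p, P' p = H (Quad.rectChart u₀' u₁' v₀' v₁' p)) →
      u₀ ≠ u₁ → v₀ ≠ v₁ → u₀' ≠ u₁' → v₀' ≠ v₁' → m ≤ P.sideDist 0 →
      (P.IsPerturbationTwo P' ρ ∨ P.IsPerturbationThree P' ρ) → ∀ η : ℝ, 0 < η → η < ρ →
        (squareCrossingLaw D η : Measure (QuadConfig D)).real
            (symmDiff (QuadConfig.crossedEvent P) (QuadConfig.crossedEvent P')) ≤ ε' := by
  obtain ⟨α₂, C₂, c₂, hα₂, hC₂, hc₂, h2⟩ :=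
    real_symmDiff_crossedEvent_le_of_isPerturbationTwo_of_tame₃_all
  obtain ⟨α₃, C₃, c₃, hα₃, hC₃, hc₃, h3⟩ :=
    real_symmDiff_crossedEvent_le_of_isPerturbationThree_of_tame_all
  obtain ⟨ρ, hρ, hρ₂, hρ₃, hb₂, hb₃⟩ := exists_rho_small (C₂ := C₂) (C₃ := C₃) hm hε' hα₂ hc₂ hα₃ hc₃
  refine ⟨ρ, hρ, ?_⟩
  intro D P P' u₀ u₁ v₀ v₁ u₀' u₁' v₀' v₁' hP hP' hu hv hu' hv' hmP hcond η hη hηρ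
  have hmd : m ≤ P.sizeParam := hmP.trans P.sideDist_zero_le_sizeParam
  have hPc : Convex ℝ P.carrier := convex_carrier_of_affine_chart hH hP hu hv
  have hP'c : Convex ℝ P'.carrier := convex_carrier_of_affine_chart hH hP' hu' hv'
  have hT1 : ∀ η : ℝ, 0 < η → η < ρ → ∀ a b : Site 2, (zdGraph 2).Adj a b →
      IsPreconnected (segment ℝ (meshPoint (η * Real.sqrt 2) a) (meshPoint (η * Real.sqrt 2) b) ∩
        P.carrier) := fun _ _ _ a b _ => isPreconnected_segment_inter_of_convex hPc _ _
  rcases hcond with htwo | hthree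
  · -- condition (2)
    have hy := apply_one_eq_of_affine_chart hH hP'
    have hT3 : ∀ s t : I, dist (P' (1, s)) (P' (1, t)) ≤ ρ → ∀ u : I,
        ((s : ℝ) ≤ u ∧ (u : ℝ) ≤ t ∨ (t : ℝ) ≤ u ∧ (u : ℝ) ≤ s) →
          dist (P' (1, u)) (P' (1, s)) ≤ 1 * ρ := fun s t hst u hu =>
      dist_le_one_mul_of_affine hy ρ s t hst u hu
    have hT4 : ∀ x ∈ P'.side 2, ∃ r > 0, ∀ u ∈ P'.carrier, u ∈ ball x r →
        segment ℝ x u ⊆ P'.carrier := fun x hx =>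
      ⟨1, one_pos, fun u hu _ => hP'c.segment_subset (P'.side_subset_carrier 2 hx) hu⟩
    have hKρ : 1 * ρ ≤ c₂ * P.sizeParam := by
      rw [one_mul]; exact hρ₂.trans (mul_le_mul_of_nonneg_left hmd hc₂.le)
    refine (h2 D P P' ρ 1 hρ le_rfl hKρ htwo hT1 hT3 hT4 η hη hηρ).trans ?_
    have := rpow_div_le_rpow_div hC₂ hρ hm hmd hα₂
    nlinarith
  · -- condition (3)
    have hx := rot_apply_one_eq_of_affine_chart hH hP'
    have hpieces : ∀ η : ℝ, 0 < η → η < ρ → ∀ p : Site 2 × Site 2, (zdGraph 2).Adj p.1 p.2 →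
        IsPreconnected (P'.piece (η * Real.sqrt 2) p) := fun _ _ _ p _ =>
      isPreconnected_segment_inter_of_convex hP'c _ _
    have hT3 : ∀ s t : I, dist (P'.rot (1, s)) (P'.rot (1, t)) ≤ ρ → ∀ u : I,
        ((s : ℝ) ≤ u ∧ (u : ℝ) ≤ t ∨ (t : ℝ) ≤ u ∧ (u : ℝ) ≤ s) →
          dist (P'.rot (1, u)) (P'.rot (1, s)) ≤ 1 * ρ := fun s t hst u hu =>
      dist_le_one_mul_of_affine hx ρ s t hst u hu
    have hcut := exists_cut_of_affine_chart hH hP hP' hu hv hthree.1 hthree.2.1 hthree.2.2.2.1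
    have hKρ : 1 * ρ ≤ c₃ * P.sizeParam := by
      rw [one_mul]; exact hρ₃.trans (mul_le_mul_of_nonneg_left hmd hc₃.le)
    refine (h3 D P P' ρ 1 hρ le_rfl hKρ hthree hT1 hpieces hT3 hcut η hη hηρ).trans ?_
    have := rpow_div_le_rpow_div hC₃ hρ hm hmd hα₃
    nlinarith

/-! ### Registered form -/

/-- **Registered sub-stub `stub_quadContinuity_parallelogram_step`** (part 2 of
`stub_quadContinuity_parallelogram`, line `hitting-tournament`): the one-step estimate of the proof
of [SchrammSmirnov2011, Lemma 5.1] for parallelogram pairs, from the tree's tame forms of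
[SchrammSmirnov2011, Lemma 6.1 (2), (3)] — parallelogram case (`exists_rho_affine_step`). -/
theorem stub_quadContinuity_parallelogram_step : ∀ (a : ℂ) (L : ℂ ≃L[ℝ] ℂ) (H : ℂ ≃ₜ ℂ), (∀ z, H z = a + L z) → ∀ m : ℝ, 0 < m → ∀ ε' : ℝ, 0 < ε' → ∃ ρ : ℝ, 0 < ρ ∧ ∀ (D : Set ℂ) (P P' : Quad D) (u₀ u₁ v₀ v₁ u₀' u₁' v₀' v₁' : ℝ), (∀ p, P p = H (Quad.rectChart u₀ u₁ v₀ v₁ p)) → (∀ p, P' p = H (Quad.rectChart u₀' u₁' v₀' v₁' p)) → u₀ ≠ u₁ → v₀ ≠ v₁ → u₀' ≠ u₁' → v₀' ≠ v₁' → m ≤ P.sideDist 0 → (P.IsPerturbationTwo P' ρ ∨ P.IsPerturbationThree P' ρ) → ∀ η : ℝ, 0 < η → η < ρ → (squareCrossingLaw D η : Measure (QuadConfig D)).real (symmDiff (QuadConfig.crossedEvent P) (QuadConfig.crossedEvent P')) ≤ ε' :=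
  fun _ _ _ hH _ hm _ hε' => exists_rho_affine_step hH hm hε'

end Summit.CriticalPhenomena.CardyFormulaZ2.Cruxes.LagHandOff.HittingTournament

end
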